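import Summits.KontsevichZagierPeriods.Zeta5Search.Barrier.ConeGammaAccounting
import Summits.KontsevichZagierPeriods.Zeta5Search.Barrier.ConeGammaRecord
import HarnessLib

/-!
# ζ(5) search — BARRIER (i): the record ray's lcm-denominator rate `(1/n) log D_n → 84 = δ₂₈` (PNT)

HONEST FRAMING (cell `pub-zeta5`): systematic search; no irrationality claim unless kernel-certified. Everything here is the
MODEL — closed-form rates under Brown–Zudilin's own denominator accounting ((28) is an «experimental observation» of
[BZ22] = arXiv:2210.03391, p. 20; (29)–(30) rides on it); nothing is a theorem about `ζ(5)`; every `γ` the cell has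
computed is `< 1` (no irrationality content); records in print UNMOVED. A «barrier» is a statement about a METHOD
CLASS (BZ's 8-fold cellular box with lcm-type denominator laws), CONDITIONAL on NAMED accounting hypotheses — not a
theorem that `ζ(5)`-approximations cannot exist. Sources: census kernel `census_bz_gamma.py` (sha256 8972266e…) as
transcribed in the cell's `BARRIER-FORMULAS.md` (c7e5c80b…); coordinator's REFINED STRUCTURE TARGET 2026-08-23,
clause (i) «formalise γ(direction)»; cell file `BARRIER-PLAN.md` §1 (theory seat cert-2 g16).

This file (5/5): `mIdx_recordVec` — the record ray's five maxima `(18,17,17,16,16)` read off the sorted multiset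
(`BrownZudilin2022.recordVec_data`); `tendsto_log_D28_recordVec` — on the record ray the `D_n` half of
`DenominatorRate` holds with the kernel value `delta28 recordDir = 84` (prime number theorem via `tendsto_log_D28_div`).
-/

noncomputable section

open Finset MeasureTheory Set Filter
open scoped Topology Pointwise

namespace Summit.KontsevichZagierPeriods.Zeta5Search.Barrier.ConeGamma

open Literature.NumberTheory.Irrationality.BrownZudilin2022 (recordVec recordVec_data)

/-- The record ray's five maxima `m = (18, 17, 17, 16, 16)` (printed, p. 28), read off the sorted multiset. -/
theorem mIdx_recordVec :
    mIdx recordVec 0 = 18 ∧ mIdx recordVec 1 = 17 ∧ mIdx recordVec 2 = 17 ∧ mIdx recordVec 3 = 16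
      ∧ mIdx recordVec 4 = 16 := by
  unfold mIdx
  rw [recordVec_data.1]
  simp

/-- Hence on the record ray the `D_n` half of `DenominatorRate` holds with the kernel value `δ₂₈ = 84`:
`(1/n) log (d_{18n} d_{17n}² d_{16n}²) → 84 = delta28 recordDir` (PNT). -/
theorem tendsto_log_D28_recordVec :
    Tendsto (fun n : ℕ => Real.log (D28 recordVec n) / n) atTop (𝓝 (delta28 recordDir)) := by
  have h := tendsto_log_D28_div recordVec
  obtain ⟨h0, h1, h2, h3, h4⟩ := mIdx_recordVec
  simp only [Fin.sum_univ_five] at h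
  rw [show ((4 : Fin 5) : ℕ) = 4 from rfl, show ((3 : Fin 5) : ℕ) = 3 from rfl, show ((2 : Fin 5) : ℕ) = 2 from rfl,
    show ((1 : Fin 5) : ℕ) = 1 from rfl, show ((0 : Fin 5) : ℕ) = 0 from rfl, h0, h1, h2, h3, h4,
    show Int.toNat 18 = 18 from rfl, show Int.toNat 17 = 17 from rfl, show Int.toNat 16 = 16 from rfl] at h
  rw [delta28_recordDir]
  convert h using 2
  norm_num

end Summit.KontsevichZagierPeriods.Zeta5Search.Barrier.ConeGamma

end
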